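import Literature.MathematicalPhysics.QuantumFieldTheory.ShenZhuZhuOrthogonal
import Literature.MathematicalPhysics.QuantumFieldTheory.ShenZhuZhuLogSobolev
import Literature.MathematicalPhysics.QuantumFieldTheory.ShenZhuZhuErgodicity
import Literature.MathematicalPhysics.QuantumFieldTheory.LatticeYangMillsBakryEmery
import Literature.MathematicalPhysics.QuantumFieldTheory.LatticeGaugeProofs
import Literature.MathematicalPhysics.QuantumFieldTheory.StrongCouplingClustering
import HarnessLib

/-!
# The DEGENERATE instances of Shen–Zhu–Zhu's named facts: the trivial group `SU(1)` and the vacuous `SO(N)` windows for `N ≤ 2`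

Seat `ym-line-csu-p1` (g40), route `ColdStartUniversality` of `Summits/QuantumFields/YangMills`, helper file G30 (`--supports
stmt-QuantumFields-24809`).  BOOKKEEPING, so that the Literature debt table for Shen–Zhu–Zhu (CMP 400 (2023)) lists exactly the substantive
open instances.  The tree types SZZ's results as parametrised named facts `X d N : Prop` / `X r d : Prop` (both structure groups, every
`d`, `N`); gens 38–39 discharged the substantive `SU(2)`, `d = 3` and `N ≤ 2` instances that the seat's packages reach.  Two families of
instances hold for TRIVIAL reasons and are recorded here once and for all:

* §1–§2 **The trivial group.** `SU(1) = SO(1) = {1}` (`subsingleton_specialUnitaryGroup_fin_one`, any commutative star-ring): the configuration space `G^{E}` is a point,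
  every observable is constant, every law is the Dirac mass.  Hence, for ANY coupling and ANY rate: the `W₂`-contraction shape
  `SZZDiracContraction` (cost `0`), uniqueness of the invariant measure `SZZUniqueInvariantMeasure`, the `L²` gap shape `SZZL2SpectralGap`
  (§2, stated for an arbitrary subsingleton structure group), and the functional inequalities `SZZFunctionalInequalitiesWith d 1 β K` (`K > 0`).
* §3 **The `SU(1)` instances**: ★ `shenZhuZhu_functionalInequalities d 1`, `shenZhuZhu_bakryEmery_transfer d 1`, `shenZhuZhu_uniqueLimit d 1`,
  `shenZhuZhu_L2SpectralGap (fundamentalLatticeRep 1) d`, `shenZhuZhu_finiteVolumeErgodicity (fundamentalLatticeRep 1) d`,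
  `shenZhuZhu_weightedContraction (fundamentalLatticeRep 1) d` — every `d`.
* §4 **The `SO(N)` windows are EMPTY for `N ≤ 2`**: SZZ's Assumption 1.1 for `SO(N)` reads `K_𝒮 = (N+2)/4 − 1 − 8N|β|(d−1) > 0`, i.e.
  `|β| < 1/(32(d−1)) − 1/(16N(d−1))` — impossible for `N ≤ 2` (`szzThresholdSO_nonpos`, `szzBakryEmeryConstSO_nonpos`, `szzErgodicRateSO_nonpos`);
  so ★ `shenZhuZhu_functionalInequalities_SO d N`, ★ `shenZhuZhu_massGap_SO d N` (`N ≤ 2`), and the `LatticeRep`-parametrised facts at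
  `soLatticeRep N`, `N ≤ 2`: `shenZhuZhu_L2SpectralGap`, `shenZhuZhu_finiteVolumeErgodicity`, `shenZhuZhu_weightedContraction` (their `SU`
  conjuncts: `N ≤ 1` trivial group; `N = 2`: `SO(2) ≠ SU(2)`, `not_isDefiningSU_soLatticeRep_two`).

THEOREMS ONLY, no definition, no sorry, no new mathematics: these instances carry NO physical content (SZZ state their theorems for
`SO(N)`/`SU(N)` under Assumption 1.1, which excludes exactly these cases or makes them trivial).  HONEST FRAMING: nothing here bears on the
crux `UniformColdStartMixing` (24809, ASIDE, not restated), on any rung, or on the summit; the Yang–Mills mass gap is NOT proved.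

Reference: H. Shen, R. Zhu, X. Zhu, CMP 400 (2023) 805–851 = arXiv:2204.12737, Assumption 1.1 / (1.3), Thm 1.2, Thm 1.4, Thm 4.2, Rem 4.6,
Lemma 5.1 [ShenZhuZhuCMP2023].
-/

set_option autoImplicit false

noncomputable section

namespace Summit.QuantumFields.YangMills.Theorems.ColdStartUniversality

open MeasureTheory ProbabilityTheory Filter Set Function
open scoped BigOperators NNReal ENNReal Topology Matrix
open Literature.MathematicalPhysics.QuantumFieldTheory
open Literature.MathematicalPhysics.QuantumLattice (fundamentalRep fundamentalLatticeRep continuous_fundamentalRep infiniteVolumeLimitPoints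
  LGConfig)
open Literature.MathematicalPhysics.QuantumFieldTheory.Balaban1983to89.TraceWordsSeparateOrbitsOrthogonal (specialOrthogonalRep
  specialOrthogonalRep_apply)

/-! ## §1. The trivial groups `SU(1)`, `SO(1)` -/

/-- `SU(1)` over any commutative star-ring is the trivial group: a `1 × 1` matrix of determinant one is `1`.  (Mathlib's
`specialOrthogonalGroup (Fin 1) ℝ` is by definition `specialUnitaryGroup (Fin 1) ℝ`, so this covers `SO(1)` too; the instance over `ℂ`
alone is also the tree's `BalabanUV.T4Continuum.HistoryRealiseCellsRunApexWitnessData.subsingleton_SU1`.) [folklore] -/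
theorem subsingleton_specialUnitaryGroup_fin_one (R : Type*) [CommRing R] [StarRing R] :
    Subsingleton (Matrix.specialUnitaryGroup (Fin 1) R) := by
  refine ⟨fun A B => Subtype.ext ?_⟩
  have hA : (A : Matrix (Fin 1) (Fin 1) R) = 1 := by
    ext i j
    fin_cases i; fin_cases j
    have h := (Matrix.mem_specialUnitaryGroup_iff.1 A.2).2
    rw [Matrix.det_fin_one] at h
    simpa using h
  have hB : (B : Matrix (Fin 1) (Fin 1) R) = 1 := by
    ext i j
    fin_cases i; fin_cases j
    have h := (Matrix.mem_specialUnitaryGroup_iff.1 B.2).2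
    rw [Matrix.det_fin_one] at h
    simpa using h
  rw [hA, hB]

/-- `SO(1) ⊆ M_1(ℝ)` is trivial. [folklore] -/
theorem subsingleton_so_one : Subsingleton (Matrix.specialOrthogonalGroup (Fin 1) ℝ) :=
  subsingleton_specialUnitaryGroup_fin_one ℝ

/-! ## §2. SZZ's dynamical conclusion shapes over a subsingleton structure group -/

section Subsingleton

variable {G : Type*} [Group G] [TopologicalSpace G] [MeasurableSpace G] [Subsingleton G]
  (r : LatticeRep G) (d L : ℕ) [NeZero L] (β' K : ℝ)

omit [TopologicalSpace G] [MeasurableSpace G] [NeZero L] in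
/-- Over a one-point structure group every configuration-valued map is the constant map. [folklore] -/
theorem gaugeConfig_eq_const {Ω : Type*} (U : Ω → GaugeConfig d L G) : U = fun _ => fun _ => 1 :=
  funext fun _ => Subsingleton.elim _ _

/-- **`W₂`-contraction shape over the trivial group** (any coupling, any rate, any cost vanishing on the diagonal): both laws are the
Dirac mass at the unique configuration, the product coupling has cost `0`. [cite: ShenZhuZhuCMP2023, Theorem 4.2] -/
theorem szzDiracContraction_of_subsingleton (c : GaugeConfig d L G → GaugeConfig d L G → ℝ) (hc : ∀ Q, c Q Q = 0) :
    SZZDiracContraction r d L β' K c := by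
  intro Ω _ P _ W hW U Q hU0 hU Ω' _ P' _ W' hW' U' Q' hU'0 hU' t
  have hc0 : ∀ Q₁ Q₂ : GaugeConfig d L G, c Q₁ Q₂ = 0 := fun Q₁ Q₂ => by
    rw [Subsingleton.elim Q₂ Q₁]; exact hc Q₁
  haveI : IsProbabilityMeasure (P.map (U t)) := by
    rw [gaugeConfig_eq_const d L (U t)]; exact Measure.isProbabilityMeasure_map measurable_const.aemeasurable
  haveI : IsProbabilityMeasure (P'.map (U' t)) := by
    rw [gaugeConfig_eq_const d L (U' t)]; exact Measure.isProbabilityMeasure_map measurable_const.aemeasurable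
  refine (szzWassersteinSq_le c (Literature.Geometry.Riemannian.isCoupling_prod (P.map (U t)) (P'.map (U' t)))).trans ?_
  simp [hc0]

/-- **Uniqueness of the invariant measure over the trivial group**: two probability measures on a one-point space coincide.
[cite: ShenZhuZhuCMP2023, Theorem 4.2] -/
theorem szzUniqueInvariantMeasure_of_subsingleton : SZZUniqueInvariantMeasure r d L β' := by
  intro Ω _ P _ W hW U hU μ ν hμ hν _ _
  ext s hs
  rcases Set.eq_empty_or_nonempty s with rfl | hne
  · simp
  · rw [Subsingleton.eq_univ_of_nonempty hne, measure_univ, measure_univ]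

variable [IsTopologicalGroup G] [CompactSpace G] [BorelSpace G]

/-- **`L²` spectral gap shape over the trivial group** (any coupling, any rate): every observable is constant, so `P_t f − μ(f) = 0`.
[cite: ShenZhuZhuCMP2023, Remark 4.6] -/
theorem szzL2SpectralGap_of_subsingleton : SZZL2SpectralGap r d L β' K := by
  intro Ω _ P _ W hW U hU f hf hbdd t
  haveI := isProbabilityMeasure_wilsonMeasure (d := d) (L := L) r.ρ r.continuous β'
  have hf1 : f = fun _ => f (fun _ => 1) := funext fun y => congrArg f (Subsingleton.elim _ _)
  have hPt : ∀ x, markovTransition U P t f x = f (fun _ => 1) := fun x => by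
    unfold markovTransition; rw [hf1]; simp
  have hmean : ∫ y, f y ∂(wilsonMeasure (d := d) (L := L) r.ρ β') = f (fun _ => 1) := by
    rw [hf1]; simp
  have hlhs : (fun x => (markovTransition U P t f x - ∫ y, f y ∂(wilsonMeasure (d := d) (L := L) r.ρ β')) ^ 2) = fun _ => 0 := by
    funext x; rw [hPt, hmean, sub_self]; simp
  rw [hlhs, integral_zero]
  exact mul_nonneg (Real.exp_pos _).le (integral_nonneg fun _ => sq_nonneg _)

end Subsingleton

/-! ## §3. The `SU(1)` instances of the named facts (every `d`) -/

section SUOne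

variable (d : ℕ)

/-- The functional-inequality shape for `SU(1)` at every coupling and every constant `K > 0`: cylinder functions of `SU(1)` links are
constant, so entropy and variance vanish. [cite: ShenZhuZhuCMP2023, Corollary 4.5] -/
theorem szzFunctionalInequalitiesWith_su_one (β : ℝ) {K : ℝ} (hK : 0 < K) : SZZFunctionalInequalitiesWith d 1 β K := by
  haveI := subsingleton_specialUnitaryGroup_fin_one ℂ
  intro μ hμ Λ f L _hf hL _hLip
  obtain ⟨_, -, hlim⟩ := hμ
  haveI : IsProbabilityMeasure μ := hlim.1
  have hF : matrixCylinder Λ f = fun _ => f (fun _ => 1) := by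
    funext U
    simp only [matrixCylinder_apply]
    congr 1
    funext e
    rw [Subsingleton.elim (U (e : Literature.MathematicalPhysics.QuantumLattice.ZdEdge d)) 1]
    rfl
  have hRHS : 0 ≤ ∑ e, L e ^ 2 := Finset.sum_nonneg fun e _ => sq_nonneg _
  set c : ℝ := f (fun _ => 1) with hc
  refine ⟨?_, ?_⟩
  · rw [hF]
    simp only [integral_const, probReal_univ, smul_eq_mul, one_mul, sub_self]
    exact mul_nonneg (div_nonneg zero_le_two hK.le) hRHS
  · have hvar : Var[(fun _ => c : LGConfig d (Matrix.specialUnitaryGroup (Fin 1) ℂ) → ℝ); μ] = 0 := by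
      rw [ProbabilityTheory.variance, ProbabilityTheory.evariance]
      simp
    rw [hF, hvar]
    exact mul_nonneg (div_nonneg zero_le_one hK.le) hRHS

/-- ★ **`shenZhuZhu_functionalInequalities d 1`** (SZZ Theorem 1.4 for the trivial group `SU(1)`, every `d`): degenerate instance.
[cite: ShenZhuZhuCMP2023, Theorem 1.4] -/
theorem shenZhuZhu_functionalInequalities_su_one : shenZhuZhu_functionalInequalities d 1 := by
  intro hd hN β hβ
  exact szzFunctionalInequalitiesWith_su_one d β ((szzBakryEmeryConstSU_pos_iff hd hN β).2 hβ)

/-- `shenZhuZhu_bakryEmery_transfer d 1` (the Bakry–Émery step with the Hessian constant as a parameter, trivial group): degenerate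
instance. [cite: ShenZhuZhuCMP2023, Theorem 4.2] -/
theorem shenZhuZhu_bakryEmery_transfer_su_one : shenZhuZhu_bakryEmery_transfer d 1 := by
  intro Λ₀ _ _ _ _ β hK
  exact szzFunctionalInequalitiesWith_su_one d β hK

/-- `shenZhuZhu_L2SpectralGap (fundamentalLatticeRep 1) d` (Remark 4.6, trivial group; the `SO` conjunct is vacuous since
`K_𝒮^{SO}(1) = −1/4 − 8|β|(d−1) < 0`): degenerate instance. [cite: ShenZhuZhuCMP2023, Remark 4.6] -/
theorem shenZhuZhu_L2SpectralGap_su_one : shenZhuZhu_L2SpectralGap (fundamentalLatticeRep 1) d := by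
  haveI := subsingleton_specialUnitaryGroup_fin_one ℂ
  refine fun _ => ⟨fun _ β _ L _ _ => szzL2SpectralGap_of_subsingleton _ d L _ _, fun _ β hK L _ _ => ?_⟩
  exact szzL2SpectralGap_of_subsingleton _ d L _ _

/-- `shenZhuZhu_finiteVolumeErgodicity (fundamentalLatticeRep 1) d` (Theorem 4.2 (1) + uniqueness of the invariant measure, trivial
group): degenerate instance. [cite: ShenZhuZhuCMP2023, Theorem 4.2] -/
theorem shenZhuZhu_finiteVolumeErgodicity_su_one : shenZhuZhu_finiteVolumeErgodicity (fundamentalLatticeRep 1) d := by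
  haveI := subsingleton_specialUnitaryGroup_fin_one ℂ
  refine fun _ => ⟨fun _ β _ L _ _ => ⟨?_, szzUniqueInvariantMeasure_of_subsingleton _ d L _⟩,
    fun _ β _ L _ _ => ⟨?_, szzUniqueInvariantMeasure_of_subsingleton _ d L _⟩⟩ <;>
  exact szzDiracContraction_of_subsingleton _ d L _ _ _ (torusRiemannDistSq_self _)

/-- The weighted cost `ρ_{∞,a}²` vanishes on the diagonal. [cite: ShenZhuZhuCMP2023, (1.4)] -/
theorem weightedRiemannDistSq_self {G : Type*} [Group G] [TopologicalSpace G] (r : LatticeRep G) {d' : ℕ} (a : ℝ)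
    (V : LGConfig d' G) : weightedRiemannDistSq r a V V = 0 := by
  simp [weightedRiemannDistSq, LatticeRep.riemannDist_self]

/-- `shenZhuZhu_weightedContraction (fundamentalLatticeRep 1) d` (Lemma 5.1, trivial group): degenerate instance.
[cite: ShenZhuZhuCMP2023, Lemma 5.1] -/
theorem shenZhuZhu_weightedContraction_su_one : shenZhuZhu_weightedContraction (fundamentalLatticeRep 1) d := by
  haveI := subsingleton_specialUnitaryGroup_fin_one ℂ
  refine fun _ a _ => ⟨fun _ β _ L _ _ => ?_, fun _ β _ L _ _ => ?_⟩ <;>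
  exact szzDiracContraction_of_subsingleton _ d L _ _ _ fun Q => weightedRiemannDistSq_self _ a _

/-- `shenZhuZhu_uniqueLimit d 1` (Theorem 1.2 (2), trivial group; the `SO(1)` conjunct is vacuous): on the one-point configuration
space every infinite-volume limit point is the Dirac mass, and the torus expectations of a cylinder observable are constantly equal to
its value. Degenerate instance. [cite: ShenZhuZhuCMP2023, Theorem 1.2] -/
theorem shenZhuZhu_uniqueLimit_su_one : shenZhuZhu_uniqueLimit d 1 := by
  haveI := subsingleton_specialUnitaryGroup_fin_one ℂ
  refine ⟨fun hd hN β hβ => ⟨?_, ?_⟩, fun hd hN β hβ => ?_⟩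
  · -- all probability measures on a one-point space coincide
    intro μ hμ ν hν
    obtain ⟨_, -, hμ'⟩ := hμ
    obtain ⟨_, -, hν'⟩ := hν
    haveI := hμ'.1; haveI := hν'.1
    ext s hs
    rcases Set.eq_empty_or_nonempty s with rfl | hne
    · simp
    · rw [Subsingleton.eq_univ_of_nonempty hne, measure_univ, measure_univ]
  · -- the Dirac mass is an infinite-volume limit (the identifier resolves to Sweep1's FREE-boundary predicate: box states)
    refine ⟨Measure.dirac (fun _ => 1), inferInstance, id, strictMono_id, fun F _ _ => ?_⟩
    have hF : F = fun _ => F (fun _ => 1) := funext fun V => congrArg F (Subsingleton.elim _ _)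
    have hlim : ∫ U, F U ∂(Measure.dirac (fun _ => (1 : Matrix.specialUnitaryGroup (Fin 1) ℂ))) = F (fun _ => 1) := by
      rw [hF]; simp
    rw [hlim]
    refine tendsto_const_nhds.congr fun k => ?_
    haveI := isProbabilityMeasure_zdWilsonMeasure (d := d) (fundamentalRep (Fin 1)) (continuous_fundamentalRep (Fin 1))
      ((((1 : ℕ) : ℝ)) * β) (Literature.Probability.LatticeModels.box d (id k))
    unfold zdExpect
    rw [hF, integral_const, smul_eq_mul, probReal_univ, one_mul]
  · -- the `SO(1)` window is empty
    exfalso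
    have h : szzThresholdSO 1 d ≤ 0 := by
      unfold szzThresholdSO
      have hd' : (2 : ℝ) ≤ d := by exact_mod_cast hd
      have h1 : 0 < 32 * ((d : ℝ) - 1) := by linarith
      have h2 : 0 < 16 * (1 : ℕ) * ((d : ℝ) - 1) := by push_cast; linarith
      rw [sub_nonpos, one_div_le_one_div h1 h2]
      push_cast; linarith
    exact lt_irrefl _ ((abs_nonneg β).trans_lt (hβ.trans_le h))

end SUOne

/-! ## §4. The `SO(N)` windows are empty for `N ≤ 2` -/

section SOSmall

variable {N d : ℕ}

/-- For `1 ≤ N ≤ 2` and `d ≥ 2`, SZZ's `SO(N)` threshold `1/(32(d−1)) − 1/(16N(d−1))` is `≤ 0`: the window (1.3) is empty.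
[cite: ShenZhuZhuCMP2023, (1.3)] -/
theorem szzThresholdSO_nonpos (hN₁ : 1 ≤ N) (hN : N ≤ 2) (hd : 2 ≤ d) : szzThresholdSO N d ≤ 0 := by
  unfold szzThresholdSO
  have hd' : (2 : ℝ) ≤ d := by exact_mod_cast hd
  have hN' : (N : ℝ) ≤ 2 := by exact_mod_cast hN
  have hN₁' : (1 : ℝ) ≤ N := by exact_mod_cast hN₁
  have h1 : 0 < 32 * ((d : ℝ) - 1) := by linarith
  have h2 : 0 < 16 * (N : ℝ) * ((d : ℝ) - 1) := by
    have : 0 < (d : ℝ) - 1 := by linarith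
    positivity
  rw [sub_nonpos, one_div_le_one_div h1 h2]
  nlinarith

/-- No coupling lies in the `SO(N)` window for `1 ≤ N ≤ 2`. [cite: ShenZhuZhuCMP2023, (1.3)] -/
theorem not_abs_lt_szzThresholdSO (hN₁ : 1 ≤ N) (hN : N ≤ 2) (hd : 2 ≤ d) (β : ℝ) : ¬ |β| < szzThresholdSO N d :=
  fun h => lt_irrefl _ ((abs_nonneg β).trans_lt (h.trans_le (szzThresholdSO_nonpos hN₁ hN hd)))

/-- For `N ≤ 2`, SZZ's `SO(N)` Bakry–Émery constant `K_𝒮 = (N+2)/4 − 1 − 8N|β|(d−1)` is `≤ 0` (every `d ≥ 1`, every `β`).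
[cite: ShenZhuZhuCMP2023, Assumption 1.1] -/
theorem szzBakryEmeryConstSO_nonpos (hN : N ≤ 2) (hd : 1 ≤ d) (β : ℝ) : szzBakryEmeryConstSO N d β ≤ 0 := by
  unfold szzBakryEmeryConstSO
  have hN' : (N : ℝ) ≤ 2 := by exact_mod_cast hN
  have hd' : (1 : ℝ) ≤ d := by exact_mod_cast hd
  have : 0 ≤ 8 * (N : ℝ) * |β| * ((d : ℝ) - 1) := by
    have : 0 ≤ (d : ℝ) - 1 := by linarith
    positivity
  linarith

/-- For `N ≤ 2` and `a ≥ 0`, SZZ's `SO(N)` ergodic rate `K̃_𝒮 = (N+2)/4 − 1 − (4+4√a)N|β|(d−1)` is `≤ 0` (every `d ≥ 1`, every `β`).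
[cite: ShenZhuZhuCMP2023, Lemma 5.1] -/
theorem szzErgodicRateSO_nonpos (hN : N ≤ 2) (hd : 1 ≤ d) (a β : ℝ) : szzErgodicRateSO a N d β ≤ 0 := by
  unfold szzErgodicRateSO szzRicciConstSO
  have hN' : (N : ℝ) ≤ 2 := by exact_mod_cast hN
  have hd' : (1 : ℝ) ≤ d := by exact_mod_cast hd
  have : 0 ≤ (4 + 4 * Real.sqrt a) * (N : ℝ) * |β| * ((d : ℝ) - 1) := by
    have : 0 ≤ (d : ℝ) - 1 := by linarith
    have : 0 ≤ Real.sqrt a := Real.sqrt_nonneg a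
    positivity
  linarith

variable (d N)

/-- ★ **`shenZhuZhu_functionalInequalities_SO d N` for `N ≤ 2`** (SZZ Theorem 1.4 / Cor. 4.5 for `SO(N)`): the window is empty, the
fact holds vacuously. Degenerate instance. [cite: ShenZhuZhuCMP2023, Corollary 4.5] -/
theorem shenZhuZhu_functionalInequalities_SO_of_le_two (hN : N ≤ 2) : shenZhuZhu_functionalInequalities_SO d N :=
  fun hd hN₁ β hβ => absurd hβ (not_abs_lt_szzThresholdSO hN₁ hN hd β)

/-- ★ **`shenZhuZhu_massGap_SO d N` for `N ≤ 2`** (SZZ Cor. 4.11 / Cor. 1.6 for `SO(N)`): the window is empty, the fact holds vacuously.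
Degenerate instance. [cite: ShenZhuZhuCMP2023, Corollary 4.11] -/
theorem shenZhuZhu_massGap_SO_of_le_two (hN : N ≤ 2) : shenZhuZhu_massGap_SO d N :=
  fun hd hN₁ β hβ => absurd hβ (not_abs_lt_szzThresholdSO hN₁ hN hd β)

/-- A real matrix read in `M_2(ℂ)` has real entries; `diag(i, −i) ∈ SU(2)` does not: **`SO(2)` (read in `ℂ`) is not `SU(2)`**, i.e. the
`SU`-scope predicate fails for `soLatticeRep 2`. [cite: ShenZhuZhuCMP2023, §1.1] -/
theorem not_isDefiningSU_soLatticeRep_two : ¬ (soLatticeRep 2).IsDefiningSU := by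
  intro h
  change Set.range (specialOrthogonalRep (Fin 2)) = (Matrix.specialUnitaryGroup (Fin 2) ℂ : Set (Matrix (Fin 2) (Fin 2) ℂ)) at h
  set A : Matrix (Fin 2) (Fin 2) ℂ := !![Complex.I, 0; 0, -Complex.I] with hA
  have hAU : A ∈ Matrix.specialUnitaryGroup (Fin 2) ℂ := by
    rw [Matrix.mem_specialUnitaryGroup_iff, Matrix.mem_unitaryGroup_iff, hA, Matrix.det_fin_two_of]
    refine ⟨?_, by simp⟩
    ext i j
    fin_cases i <;> fin_cases j <;> simp [Matrix.mul_apply, Matrix.star_apply]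
  have hmem : A ∈ Set.range (specialOrthogonalRep (Fin 2)) := by rw [h]; exact hAU
  obtain ⟨Q, hQ⟩ := hmem
  have h00 := congrArg (fun M : Matrix (Fin 2) (Fin 2) ℂ => (M 0 0).im) hQ
  simp [specialOrthogonalRep_apply, hA] at h00

/-- `shenZhuZhu_L2SpectralGap (soLatticeRep N) d` for `N ≤ 2` (Remark 4.6 for `SO(N)`): the `SO` conjunct is vacuous (`K_𝒮 ≤ 0`); the
`SU` conjunct is trivial for `N ≤ 1` (one-point group) and vacuous for `N = 2` (`SO(2) ≠ SU(2)`). Degenerate instance.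
[cite: ShenZhuZhuCMP2023, Remark 4.6] -/
theorem shenZhuZhu_L2SpectralGap_so_of_le_two (hN : N ≤ 2) : shenZhuZhu_L2SpectralGap (soLatticeRep N) d := by
  refine fun hd => ⟨fun hSU β hK L _ hL => ?_, fun _ β hK L _ _ => ?_⟩
  · -- `SU` conjunct
    rcases Nat.lt_or_ge N 2 with hlt | hge
    · -- `N ≤ 1`: `SO(N)` is a point (`N = 0`: the empty matrix; `N = 1`)
      haveI : Subsingleton (Matrix.specialOrthogonalGroup (Fin N) ℝ) := by
        interval_cases N
        · exact ⟨fun A B => Subtype.ext (Subsingleton.elim _ _)⟩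
        · exact subsingleton_so_one
      exact szzL2SpectralGap_of_subsingleton _ d L _ _
    · exact absurd (le_antisymm hN hge ▸ hSU) (by
        have h2 : N = 2 := le_antisymm hN hge
        subst h2
        exact not_isDefiningSU_soLatticeRep_two)
  · exact absurd hK (not_lt.2 (szzBakryEmeryConstSO_nonpos hN (by omega) β))

/-- `shenZhuZhu_finiteVolumeErgodicity (soLatticeRep N) d` for `N ≤ 2` (Theorem 4.2 for `SO(N)`): vacuous / trivial as above. Degenerate
instance. [cite: ShenZhuZhuCMP2023, Theorem 4.2] -/
theorem shenZhuZhu_finiteVolumeErgodicity_so_of_le_two (hN : N ≤ 2) : shenZhuZhu_finiteVolumeErgodicity (soLatticeRep N) d := by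
  refine fun hd => ⟨fun hSU β hK L _ hL => ?_, fun _ β hK L _ _ => ?_⟩
  · rcases Nat.lt_or_ge N 2 with hlt | hge
    · haveI : Subsingleton (Matrix.specialOrthogonalGroup (Fin N) ℝ) := by
        interval_cases N
        · exact ⟨fun A B => Subtype.ext (Subsingleton.elim _ _)⟩
        · exact subsingleton_so_one
      exact ⟨szzDiracContraction_of_subsingleton _ d L _ _ _ (torusRiemannDistSq_self _),
        szzUniqueInvariantMeasure_of_subsingleton _ d L _⟩
    · have h2 : N = 2 := le_antisymm hN hge
      subst h2
      exact absurd hSU not_isDefiningSU_soLatticeRep_two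
  · exact absurd hK (not_lt.2 (szzBakryEmeryConstSO_nonpos hN (by omega) β))

/-- `shenZhuZhu_weightedContraction (soLatticeRep N) d` for `N ≤ 2` (Lemma 5.1 for `SO(N)`): vacuous / trivial as above. Degenerate instance.
[cite: ShenZhuZhuCMP2023, Lemma 5.1] -/
theorem shenZhuZhu_weightedContraction_so_of_le_two (hN : N ≤ 2) : shenZhuZhu_weightedContraction (soLatticeRep N) d := by
  refine fun hd a ha => ⟨fun hSU β hK L _ hL => ?_, fun _ β hK L _ _ => ?_⟩
  · rcases Nat.lt_or_ge N 2 with hlt | hge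
    · haveI : Subsingleton (Matrix.specialOrthogonalGroup (Fin N) ℝ) := by
        interval_cases N
        · exact ⟨fun A B => Subtype.ext (Subsingleton.elim _ _)⟩
        · exact subsingleton_so_one
      exact szzDiracContraction_of_subsingleton _ d L _ _ _ fun Q => weightedRiemannDistSq_self _ a _
    · have h2 : N = 2 := le_antisymm hN hge
      subst h2
      exact absurd hSU not_isDefiningSU_soLatticeRep_two
  · exact absurd hK (not_lt.2 (szzErgodicRateSO_nonpos hN (by omega) a β))

end SOSmall

end Summit.QuantumFields.YangMills.Theorems.ColdStartUniversality

end
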